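import Summits.BirchSwinnertonDyer.BirchSwinnertonDyer.Theorems.ByReductionTypeAtTwoRankOneAtTwoBigImageOddLocalOneDoorHalvesJoint
import Summits.BirchSwinnertonDyer.BirchSwinnertonDyer.Theorems.ByReductionTypeAtTwoRankOneAtTwoBigImageOddLocalOneDoorHalvesJointDoor
import HarnessLib

/-!
# Route ByReductionTypeAtTwo, crux `RankOneAtTwoBigImageOddLocal` (stmt-BirchSwinnertonDyer-23715), LINE v8.6 `one_door_analytic`:
# the CROSSED halves on the slice, the twist-unit lever, and the inter-route bridge from 22137's registered K-side upper stub

Width prover seat `bsd-line-fkl-p2` g9 (2026-08-28), `--supports stmt-BirchSwinnertonDyer-23715`.  THEOREMS ONLY; nothing is asserted;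
BSD is not proved by any of this.  Sequel of `…OneDoorHalvesJoint.lean`, `…OneDoorHalvesJointDoor.lean`, `…OneDoorHalvesJointSlice.lean`.

Since the `2`-adic BSD defects of a door pair satisfy `def(W ⊗ K) = def(W) + def(Wd)` and U / L are the joint halves of the pair:

* §7 `missingUpperBoundAt_two_onSlice_of_doorIndexLawUpperCAtTwo_of_rankZeroLower` — **the Euler-system half of `BSD₂(W)` on the whole
  slice ⟸ U + ONLY THE LOWER (main-conjecture) HALF of rank-`0` `BSD₂` of non-CM curves** (g8's p628851 spends full `S_rankZeroTwin`);
  `missingLowerBoundAt_two_onSlice_of_doorIndexLawLowerCAtTwo_of_rankZeroUpper` — **the main-conjecture half of `BSD₂(W)` ⟸ L + ONLY THE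
  UPPER (Kato / Euler-system) HALF of rank-`0` `BSD₂`**; the fkl residue (5b) `RankOneAtTwoFkl.ShaAnTwoIntegralOnBigImageSlice` under
  U + rank-`0` lower; and the TWIST-UNIT LEVER: U + a door whose twin has `ord₂ #Ш_an(Wd) ≤ 0` (an ANALYTIC supply statement about
  quadratic twists, censusable by modular symbols) ⟹ the Euler-system half of `BSD₂(W)` with NO rank-`0` `BSD₂` input at all.
* §8 `doorIndexLawUpperCAtTwo_of_upperBoundAtTwo_uncorrected_of_manin` — the INTER-ROUTE bridge: route GenusKolyvaginAtTwo's REGISTERED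
  `stub_upperBoundAtTwo` of crux 22137 (signature verbatim: `#Ш(E_K)[2^∞] ∣ 4^{M₀}`, no `c`-correction) + the odd-constant datum `S_manin`
  (PRINT at `4 ∤ N`) ⟹ U, modulo PRINT — a landing of that stub closes the child U on `4 ∤ N` and, at `4 ∣ N`, modulo `ManinOddAdditiveLevelAtTwo`.

Net for the pen: child U of 23715 meets the route's rank-`0` cruxes 19095–19098 only through their LOWER halves, child L only through their
UPPER halves (cf. 19098's `stub_addDefectUpper`, 19097's `stub_allMillerLower`), and the Euler-system half can bypass them by a door choice.

References: [GrossLMS1991] Thm. 1.3, §2 Conj. (2.2), §4; [KolyvaginEulerSystems1990] Thm. A; [HoffsteinLuo1997] Theorem §1;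
[Milne1972ArithmeticAV] §1 Thm. 1; [Cesnavicius2018] Thm. 1.2; [Miller2011LMS] Def. 1.1.
-/

set_option autoImplicit false
-- the Theorems namespace of this sub repeats the summit name by design (D-0017 nested layout)
set_option linter.dupNamespace false

noncomputable section

open scoped Classical

namespace Summit.BirchSwinnertonDyer.BirchSwinnertonDyer.Theorems.RankOneAtTwoOneDoor

open WeierstrassCurve NumberField Literature.NumberTheory.EllipticCurves Literature.NumberTheory.EllipticCurves.ModularForms
  Literature.NumberTheory.EllipticCurves.Rank1Residual
  Literature.NumberTheory.EllipticCurves.Rank1Residual.Typed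
  Literature.NumberTheory.EllipticCurves.KrizLi2019
  Summit.BirchSwinnertonDyer.Rank1Residual
  Summit.BirchSwinnertonDyer.Rank1Residual.AdditivePotMult
  Summit.BirchSwinnertonDyer.Rank1Residual.F1Sign2
  Summit.BirchSwinnertonDyer.Rank1Residual.F1Sign2.TranspositionDoor
  Summit.BirchSwinnertonDyer.BirchSwinnertonDyer.Theses.ByReductionTypeAtTwo
  Summit.BirchSwinnertonDyer.BirchSwinnertonDyer.Theorems.CMExactDescent
  Summit.BirchSwinnertonDyer.BirchSwinnertonDyer.Theorems.SchneiderFree.Upper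

/-! ### §7 The crossings on the slice: each half of `BSD₂(W)` costs its named half plus the OPPOSITE half of rank-`0` `BSD₂` of the twin -/

/-- The PRINT-only door package of a slice curve (= `exists_doorPackage_onSlice_primary`, p628011, WITHOUT `S_rankZeroTwin`): a
door-admissible Heegner field with `L(E^{(d_K)},1) ≠ 0` (Hoffstein–Luo), a datum (modularity), a Heegner datum, an embedding, the
`K`-rational Heegner point, and a globally minimal NON-CM twin of analytic rank `0`. [cite: HoffsteinLuo1997, Theorem (§1, pp. 435–436)]
[cite: GrossZagier1986, V.§2] -/
theorem exists_doorPackage_onSlice_print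
    (hnf : exists_isNewformOf) (hHL : HoffsteinLuo1997_exists_twist_L_one_ne_zero)
    (W : WeierstrassCurve ℚ) [W.IsElliptic] [W.IsGloballyMinimal] [NeZero (W.conductorNorm ℤ)]
    (hCM : ¬ W.HasCM) (hr : W.analyticRank = 1) :
    ∃ (K : Type) (_ : Field K) (_ : NumberField K), IsImaginaryQuadratic K ∧ DoorAdmissible W (NumberField.discr K) ∧
      (W.quadraticTwist (NumberField.discr K : ℚ)).entireLFunction 1 ≠ 0 ∧
      ∃ (Dt : ModularParametrizationData W (W.conductorNorm ℤ)) (H : HeegnerDatum (W.conductorNorm ℤ) (NumberField.discr K))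
        (ι : K →+* ℂ) (P : (W.baseChange K).toAffine.Point) (Cd : VariableChange ℚ),
        WeierstrassCurve.Affine.Point.map ι.toRatAlgHom P = heegnerPointComplex Dt H ∧
        (Cd • W.quadraticTwist (NumberField.discr K : ℚ)).IsElliptic ∧
        ∃ _ : (Cd • W.quadraticTwist (NumberField.discr K : ℚ)).IsGloballyMinimal,
          ¬ (Cd • W.quadraticTwist (NumberField.discr K : ℚ)).HasCM ∧ (Cd • W.quadraticTwist (NumberField.discr K : ℚ)).analyticRank = 0 := by
  have hmod : hasEntireLFunction_rat := hasEntireLFunction_rat_of_exists_isNewformOf hnf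
  obtain ⟨K, _iF, _iN, hK, hadm, hLt, -, hHN⟩ := doorSupplyAnalyticAtTwo_of_hoffsteinLuo hnf hHL W hr
  obtain ⟨Dt⟩ := (nonempty_modularParametrizationData_iff_exists_isNewformOf_unconditional.mpr hnf) W
  obtain ⟨H, -⟩ :=
    nonempty_heegnerDatum_holds (W.conductorNorm ℤ) K hK (exists_dvd_sq_sub_discr_holds (W.conductorNorm ℤ) K hK hHN).choose_spec
  obtain ⟨ι⟩ : Nonempty (K →+* ℂ) := inferInstance
  obtain ⟨P, hP⟩ := heegnerPointComplex_mem_range_map_holds (W.conductorNorm ℤ) W K hK hHN Dt H ι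
  have hD0 : (NumberField.discr K : ℚ) ≠ 0 := by exact_mod_cast NumberField.discr_ne_zero K
  haveI hEt : (W.quadraticTwist (NumberField.discr K : ℚ)).IsElliptic := W.isElliptic_quadraticTwist hD0
  obtain ⟨Cd, hCd⟩ := hasGlobalMinimalModel_rat_holds (W.quadraticTwist (NumberField.discr K : ℚ))
  haveI : (Cd • W.quadraticTwist (NumberField.discr K : ℚ)).IsGloballyMinimal := hCd
  have hCMd : ¬ (Cd • W.quadraticTwist (NumberField.discr K : ℚ)).HasCM :=
    RamifiedPairUpperBound.not_hasCM_of_smul_quadraticTwist_eq hD0 rfl hCM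
  have hLeq : (Cd • W.quadraticTwist (NumberField.discr K : ℚ)).entireLFunction =
      (W.quadraticTwist (NumberField.discr K : ℚ)).entireLFunction := by
    rw [entireLFunction_smul]
  have hrd : (Cd • W.quadraticTwist (NumberField.discr K : ℚ)).analyticRank = 0 :=
    ((Cd • W.quadraticTwist _).analyticRank_eq_zero_iff_holds (hmod _)).2 (by rw [hLeq]; exact hLt)
  exact ⟨K, _iF, _iN, hK, hadm, hLt, Dt, H, ι, P, Cd, hP, inferInstance, hCd, hCMd, hrd⟩

/-- **THE EULER-SYSTEM HALF OF `BSD₂` ON THE WHOLE SLICE from U and ONLY THE LOWER HALF of rank-`0` `BSD₂` of non-CM curves** (`hZL`: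
`Typed.MissingLowerBoundAt V 2` for every non-CM globally minimal `V` of analytic rank `0` — the main-conjecture / Skinner–Urban direction at
`2`, in place of g8's full `S_rankZeroTwin`), the four primary facts: at the Hoffstein–Luo door, U is the joint upper half (§2) and the
twin's lower half crosses it to `ord₂ #Ш(W) ≤ ord₂ #Ш_an(W)` (`SchneiderFree.Upper.missingUpperBoundAt_of_jointUpper_of_lower`).  Conditional
by design. [cite: GrossLMS1991, Thm. 1.3 and §2 Conj. (2.2)] [cite: Miller2011LMS, Def. 1.1] -/
theorem missingUpperBoundAt_two_onSlice_of_doorIndexLawUpperCAtTwo_of_rankZeroLower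
    (hGZ : ∀ (N : ℕ) [NeZero N] (W : WeierstrassCurve ℚ) (K : Type) [Field K] [NumberField K], gross_zagier N W K)
    (hKo : ∀ (N : ℕ) [NeZero N] (W : WeierstrassCurve ℚ) (K : Type) [Field K] [NumberField K], kolyvagin N W K)
    (hGZK : rank_eq_analyticRank_of_analyticRank_le_one) (hnf : exists_isNewformOf)
    (hHL : HoffsteinLuo1997_exists_twist_L_one_ne_zero) (hU : DoorIndexLawUpperCAtTwo)
    (hZL : ∀ (V : WeierstrassCurve ℚ) [V.IsElliptic] [V.IsGloballyMinimal], ¬ V.HasCM → V.analyticRank = 0 → MissingLowerBoundAt V 2) :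
    ∀ (W : WeierstrassCurve ℚ) [W.IsElliptic] [W.IsGloballyMinimal], ¬ W.HasCM →
      (∀ n : ℕ, W.HasSurjectiveModNGaloisRep ((2 ^ n : ℕ) : ℤ)) → Odd W.torsionOrder → Odd W.tamagawaProduct →
      W.analyticRank = 1 → MissingUpperBoundAt W 2 := by
  intro W _ _ hCM hsurj hT hc hr
  haveI hN : NeZero (W.conductorNorm ℤ) := ⟨(W.conductorNorm_pos_holds).ne'⟩
  obtain ⟨K, _iF, _iN, hK, hadm, hLt, Dt, H, ι, P, Cd, hP, _, _, hCMd, hrd⟩ := exists_doorPackage_onSlice_print hnf hHL W hCM hr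
  have hJ : JointUpperBoundAt W (Cd • W.quadraticTwist (NumberField.discr K : ℚ)) 2 :=
    (jointUpperBoundAt_two_iff_doorLawGeC_at W hT hc hr K hK (hGZ _ W K) (hKo _ W K) hadm hLt Dt H ι P hP _ Cd rfl hnf hGZK).mpr
      (hU W hCM hsurj hT hc hr K hK hadm hLt Dt H ι P hP _ Cd rfl)
  exact missingUpperBoundAt_of_jointUpper_of_lower hJ (hZL _ hCMd hrd)

/-- **THE MAIN-CONJECTURE HALF OF `BSD₂` ON THE WHOLE SLICE from L and ONLY THE UPPER HALF of rank-`0` `BSD₂` of non-CM curves** (`hZU`: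
`Typed.MissingUpperBoundAt V 2` for every non-CM globally minimal `V` of analytic rank `0` — Kato's / the Euler-system direction at `2`), the
four primary facts.  Conditional by design. [cite: GrossLMS1991, §2 Conj. (2.2)] [cite: Miller2011LMS, Def. 1.1] -/
theorem missingLowerBoundAt_two_onSlice_of_doorIndexLawLowerCAtTwo_of_rankZeroUpper
    (hGZ : ∀ (N : ℕ) [NeZero N] (W : WeierstrassCurve ℚ) (K : Type) [Field K] [NumberField K], gross_zagier N W K)
    (hKo : ∀ (N : ℕ) [NeZero N] (W : WeierstrassCurve ℚ) (K : Type) [Field K] [NumberField K], kolyvagin N W K)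
    (hGZK : rank_eq_analyticRank_of_analyticRank_le_one) (hnf : exists_isNewformOf)
    (hHL : HoffsteinLuo1997_exists_twist_L_one_ne_zero) (hL : DoorIndexLawLowerCAtTwo)
    (hZU : ∀ (V : WeierstrassCurve ℚ) [V.IsElliptic] [V.IsGloballyMinimal], ¬ V.HasCM → V.analyticRank = 0 → MissingUpperBoundAt V 2) :
    ∀ (W : WeierstrassCurve ℚ) [W.IsElliptic] [W.IsGloballyMinimal], ¬ W.HasCM →
      (∀ n : ℕ, W.HasSurjectiveModNGaloisRep ((2 ^ n : ℕ) : ℤ)) → Odd W.torsionOrder → Odd W.tamagawaProduct →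
      W.analyticRank = 1 → MissingLowerBoundAt W 2 := by
  intro W _ _ hCM hsurj hT hc hr
  haveI hN : NeZero (W.conductorNorm ℤ) := ⟨(W.conductorNorm_pos_holds).ne'⟩
  obtain ⟨K, _iF, _iN, hK, hadm, hLt, Dt, H, ι, P, Cd, hP, _, _, hCMd, hrd⟩ := exists_doorPackage_onSlice_print hnf hHL W hCM hr
  have hJ : JointLowerBoundAt W (Cd • W.quadraticTwist (NumberField.discr K : ℚ)) 2 :=
    (jointLowerBoundAt_two_iff_doorLawLeC_at W hT hc hr K hK (hGZ _ W K) (hKo _ W K) hadm hLt Dt H ι P hP _ Cd rfl hnf hGZK).mpr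
      (hL W hCM hsurj hT hc hr K hK hadm hLt Dt H ι P hP _ Cd rfl)
  exact missingLowerBoundAt_of_joint_of_upper hJ (hZU _ hCMd hrd)

/-- **The fkl residue (5b) `RankOneAtTwoFkl.ShaAnTwoIntegralOnBigImageSlice` («`#Ш_an(W)` is a `2`-adic integer on the slice») from U and
ONLY THE LOWER HALF of rank-`0` `BSD₂`** (`0 ≤ ord₂ #Ш(W) ≤ ord₂ #Ш_an(W)`; compare p628851 / p627493, which use `S_rankZeroTwin`).
Conditional by design. [cite: GrossLMS1991, Thm. 1.3] [cite: Miller2011LMS, Def. 1.1] -/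
theorem shaAnTwoIntegralOnBigImageSlice_of_doorIndexLawUpperCAtTwo_of_rankZeroLower
    (hGZ : ∀ (N : ℕ) [NeZero N] (W : WeierstrassCurve ℚ) (K : Type) [Field K] [NumberField K], gross_zagier N W K)
    (hKo : ∀ (N : ℕ) [NeZero N] (W : WeierstrassCurve ℚ) (K : Type) [Field K] [NumberField K], kolyvagin N W K)
    (hGZK : rank_eq_analyticRank_of_analyticRank_le_one) (hnf : exists_isNewformOf)
    (hHL : HoffsteinLuo1997_exists_twist_L_one_ne_zero) (hU : DoorIndexLawUpperCAtTwo)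
    (hZL : ∀ (V : WeierstrassCurve ℚ) [V.IsElliptic] [V.IsGloballyMinimal], ¬ V.HasCM → V.analyticRank = 0 → MissingLowerBoundAt V 2) :
    RankOneAtTwoFkl.ShaAnTwoIntegralOnBigImageSlice := by
  intro W _ _ hCM hsurj hT hc hr q hq
  obtain ⟨q', hq', hle⟩ :=
    missingUpperBoundAt_two_onSlice_of_doorIndexLawUpperCAtTwo_of_rankZeroLower hGZ hKo hGZK hnf hHL hU hZL W hCM hsurj hT hc hr
  have hqq : q = q' := by exact_mod_cast hq.symm.trans hq'
  rw [hqq]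
  exact le_trans (by exact_mod_cast Nat.zero_le _) hle

/-- **THE TWIST-UNIT LEVER on the slice: U and a door whose twin has `ord₂ #Ш_an(Wd) ≤ 0` give the Euler-system half of `BSD₂(W)` with
NO rank-`0` `BSD₂` input at all** (`SchneiderFree.Upper.missingUpperBoundAt_of_jointUpper_of_twistUnit`: `0 ≤ ord₂ #Ш(Wd)` trivially).  Per
datum: for `W` on the slice, a door-admissible `K` with `L(W^{(d_K)},1) ≠ 0`, any datum and Heegner point, a globally minimal twin `Wd`
and a rational value `q'` of `#Ш_an(Wd)` with `ord₂ q' ≤ 0` (rank `0`: `#Ш_an(Wd) = L(Wd,1)·#T² / (Ω(Wd)·∏ c_ℓ(Wd))`, computable by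
modular symbols; `BSD₂(Wd)` predicts `ord₂ #Ш_an(Wd) = ord₂ #Ш(Wd)[2^∞] ≥ 0` with equality iff `Ш(Wd)[2] = 0`).  So the rank-`0` input
of the Euler-system half can be traded for the CHOICE of a door whose twin has `2`-adic unit analytic `Ш` — an analytic supply statement.
Conditional on U by design. [cite: GrossLMS1991, Thm. 1.3] [cite: Miller2011LMS, Def. 1.1] -/
theorem missingUpperBoundAt_two_of_doorIndexLawUpperCAtTwo_of_unitTwin_at
    (hGZK : rank_eq_analyticRank_of_analyticRank_le_one) (hnf : exists_isNewformOf) (hU : DoorIndexLawUpperCAtTwo)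
    (W : WeierstrassCurve ℚ) [W.IsElliptic] [W.IsGloballyMinimal] [NeZero (W.conductorNorm ℤ)]
    (hCM : ¬ W.HasCM) (hsurj : ∀ n : ℕ, W.HasSurjectiveModNGaloisRep ((2 ^ n : ℕ) : ℤ)) (hT : Odd W.torsionOrder)
    (hc : Odd W.tamagawaProduct) (hr : W.analyticRank = 1)
    (K : Type) [Field K] [NumberField K] (hK : IsImaginaryQuadratic K)
    (hGZ : gross_zagier (W.conductorNorm ℤ) W K) (hKo : kolyvagin (W.conductorNorm ℤ) W K)
    (hadm : DoorAdmissible W (NumberField.discr K))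
    (hLt : (W.quadraticTwist (NumberField.discr K : ℚ)).entireLFunction 1 ≠ 0)
    (Dt : ModularParametrizationData W (W.conductorNorm ℤ))
    (H : HeegnerDatum (W.conductorNorm ℤ) (NumberField.discr K)) (ι : K →+* ℂ)
    (P : (W.baseChange K).toAffine.Point)
    (hP : WeierstrassCurve.Affine.Point.map ι.toRatAlgHom P = heegnerPointComplex Dt H)
    (Wd : WeierstrassCurve ℚ) [Wd.IsElliptic] [Wd.IsGloballyMinimal] (Cd : VariableChange ℚ)
    (hWd : Cd • W.quadraticTwist (NumberField.discr K : ℚ) = Wd)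
    (hunit : ∃ q' : ℚ, shaAn Wd = (q' : ℂ) ∧ padicValRat 2 q' ≤ 0) :
    MissingUpperBoundAt W 2 := by
  have hJ : JointUpperBoundAt W Wd 2 :=
    (jointUpperBoundAt_two_iff_doorLawGeC_at W hT hc hr K hK hGZ hKo hadm hLt Dt H ι P hP Wd Cd hWd hnf hGZK).mpr
      (hU W hCM hsurj hT hc hr K hK hadm hLt Dt H ι P hP Wd Cd hWd)
  exact missingUpperBoundAt_of_jointUpper_of_twistUnit hJ hunit

/-- **The Euler-system half of `BSD₂` on the whole slice from U and a UNIT-TWIN DOOR SUPPLY** (`hSup`: every `W` on the slice has a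
door-admissible `K` with `L(W^{(d_K)},1) ≠ 0` and a globally minimal twin whose `#Ш_an` has `ord₂ ≤ 0` — an ANALYTIC statement about
quadratic twists of slice curves, Zhai / Cai–Li–Zhai / Kriz–Li type, censusable by modular symbols), the four primary facts; NO rank-`0`
`BSD₂` input.  Conditional by design; nothing is asserted about `hSup`. [cite: GrossLMS1991, Thm. 1.3] [cite: Miller2011LMS, Def. 1.1] -/
theorem missingUpperBoundAt_two_onSlice_of_doorIndexLawUpperCAtTwo_of_unitTwinSupply
    (hGZ : ∀ (N : ℕ) [NeZero N] (W : WeierstrassCurve ℚ) (K : Type) [Field K] [NumberField K], gross_zagier N W K)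
    (hKo : ∀ (N : ℕ) [NeZero N] (W : WeierstrassCurve ℚ) (K : Type) [Field K] [NumberField K], kolyvagin N W K)
    (hGZK : rank_eq_analyticRank_of_analyticRank_le_one) (hnf : exists_isNewformOf) (hU : DoorIndexLawUpperCAtTwo)
    (hSup : ∀ (W : WeierstrassCurve ℚ) [W.IsElliptic] [W.IsGloballyMinimal] [NeZero (W.conductorNorm ℤ)],
      ¬ W.HasCM → (∀ n : ℕ, W.HasSurjectiveModNGaloisRep ((2 ^ n : ℕ) : ℤ)) → Odd W.torsionOrder → Odd W.tamagawaProduct →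
      W.analyticRank = 1 →
      ∃ (K : Type) (_ : Field K) (_ : NumberField K), IsImaginaryQuadratic K ∧ DoorAdmissible W (NumberField.discr K) ∧
        (W.quadraticTwist (NumberField.discr K : ℚ)).entireLFunction 1 ≠ 0 ∧
        ∃ (Wd : WeierstrassCurve ℚ) (_ : Wd.IsElliptic) (_ : Wd.IsGloballyMinimal) (Cd : VariableChange ℚ),
          Cd • W.quadraticTwist (NumberField.discr K : ℚ) = Wd ∧ ∃ q' : ℚ, shaAn Wd = (q' : ℂ) ∧ padicValRat 2 q' ≤ 0) :
    ∀ (W : WeierstrassCurve ℚ) [W.IsElliptic] [W.IsGloballyMinimal], ¬ W.HasCM →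
      (∀ n : ℕ, W.HasSurjectiveModNGaloisRep ((2 ^ n : ℕ) : ℤ)) → Odd W.torsionOrder → Odd W.tamagawaProduct →
      W.analyticRank = 1 → MissingUpperBoundAt W 2 := by
  intro W _ _ hCM hsurj hT hc hr
  haveI hN : NeZero (W.conductorNorm ℤ) := ⟨(W.conductorNorm_pos_holds).ne'⟩
  obtain ⟨K, _iF, _iN, hK, hadm, hLt, Wd, _iE, _iM, Cd, hWd, hunit⟩ := hSup W hCM hsurj hT hc hr
  have hHN : SatisfiesHeegnerHypothesis (W.conductorNorm ℤ) K := satisfiesHeegnerHypothesis_of_doorAdmissible W K hK hadm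
  obtain ⟨Dt⟩ := (nonempty_modularParametrizationData_iff_exists_isNewformOf_unconditional.mpr hnf) W
  obtain ⟨H, -⟩ :=
    nonempty_heegnerDatum_holds (W.conductorNorm ℤ) K hK (exists_dvd_sq_sub_discr_holds (W.conductorNorm ℤ) K hK hHN).choose_spec
  obtain ⟨ι⟩ : Nonempty (K →+* ℂ) := inferInstance
  obtain ⟨P, hP⟩ := heegnerPointComplex_mem_range_map_holds (W.conductorNorm ℤ) W K hK hHN Dt H ι
  exact missingUpperBoundAt_two_of_doorIndexLawUpperCAtTwo_of_unitTwin_at hGZK hnf hU W hCM hsurj hT hc hr K hK (hGZ _ W K) (hKo _ W K)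
    hadm hLt Dt H ι P hP Wd Cd hWd hunit

/-! ### §8 The inter-route bridge: route GenusKolyvaginAtTwo's registered K-side UPPER stub of crux 22137 + the Manin stub ⟹ U -/

/-- **AN-28c-U from the REGISTERED `stub_upperBoundAtTwo` of crux `KolyvaginExactAtTwo` (stmt-22137, route GenusKolyvaginAtTwo; signature
VERBATIM as binder `hX`: Kolyvagin's upper bound `#Ш(E_K)[2^∞] ∣ 4^{M₀}` WITHOUT the `c`-correction, for every datum) together with the
odd-constant datum `S_manin` (PRINT at `4 ∤ N` by Abbes–Ullmo / Česnavičius, `…OneDoorManin.lean`; OPEN only at `4 ∣ N`), modulo PRINT.**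
At an odd-constant datum the uncorrected bound IS the c-corrected one (`v₂(c) = 0`), which is the upper half over `K` (§3); that is
datum-free, so it is the joint upper half of EVERY door pair (§1) and hence U's inequality at EVERY datum of the door (§2), whatever its
constant.  Reading: a landing of 22137's `stub_upperBoundAtTwo` closes the child U of 23715 on `4 ∤ N` outright and on `4 ∣ N` modulo the
`2`-primary Manin conjecture (`ManinOddAdditiveLevelAtTwo`).  Conditional by design; BSD is not proved by this.
[cite: GrossLMS1991, Thm. 1.3 and §4] [cite: KolyvaginEulerSystems1990, Thm. A] [cite: Cesnavicius2018, Thm. 1.2] -/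
theorem doorIndexLawUpperCAtTwo_of_upperBoundAtTwo_uncorrected_of_manin
    (hGZ : ∀ (N : ℕ) [NeZero N] (W : WeierstrassCurve ℚ) (K : Type) [Field K] [NumberField K], gross_zagier N W K)
    (hKo : ∀ (N : ℕ) [NeZero N] (W : WeierstrassCurve ℚ) (K : Type) [Field K] [NumberField K], kolyvagin N W K)
    (hGZK : rank_eq_analyticRank_of_analyticRank_le_one) (hnf : exists_isNewformOf)
    (hMilneC : Milne1972.bsdQuotient_baseChange_quadratic_anyModel)
    (hX : ∀ (W : WeierstrassCurve ℚ) [W.IsElliptic] [W.IsGloballyMinimal] [NeZero (W.conductorNorm ℤ)], ¬ W.HasCM →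
      ∀ (K : Type) [Field K] [NumberField K], IsImaginaryQuadratic K → Odd (NumberField.discr K) → NumberField.discr K ≠ -3 →
      SatisfiesHeegnerHypothesis (W.conductorNorm ℤ) K → ¬ IsSquare ((NumberField.discr K : ℚ) * -|W.Δ|) →
      ¬ IsSquare ((NumberField.discr K : ℚ) * (-(2 * |W.Δ|))) → (∀ n : ℕ, 0 < n → W.HasSurjectiveModNGaloisRep ((2 : ℤ) ^ n)) →
      ∀ (Dt : ModularParametrizationData W (W.conductorNorm ℤ)) (β : ℤ) (ι : K →+* ℂ) (d₁ : KolyvaginHeegnerData Dt β ι 1),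
      ¬ IsOfFinAddOrder d₁.derivedPoint → ∀ (M₀ : ℕ),
      (¬ ∃ Q : (W.baseChange (ringClassField K ι 1)).toAffine.Point, ((2 ^ (M₀ + 1) : ℕ) : ℤ) • Q = d₁.derivedPoint) →
      Nat.card (AddCommGroup.primaryComponent (W.baseChange K).sha 2) ∣ 2 ^ (2 * M₀))
    (hMan : S_manin) : DoorIndexLawUpperCAtTwo := by
  intro W _ _ _ hCM hsurj hT hc hr K _ _ hK hadm hLt Dt H ι P hP Wd _ _ Cd hWd m hm
  haveI : Fact (Nat.Prime 2) := ⟨Nat.prime_two⟩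
  have hmod : hasEntireLFunction_rat := hasEntireLFunction_rat_of_exists_isNewformOf hnf
  have h2 : Module.finrank ℚ K = 2 := hK.1
  obtain ⟨hodd, h3, hsq1, hsq2⟩ := kolyvaginAdmissible_of_doorAdmissible W hadm
  have hH : SatisfiesHeegnerHypothesis (W.conductorNorm ℤ) K := satisfiesHeegnerHypothesis_of_doorAdmissible W K hK hadm
  have hρ : ∀ n : ℕ, 0 < n → W.HasSurjectiveModNGaloisRep ((2 : ℤ) ^ n) := fun n _ => by
    have h := hsurj n
    push_cast at h
    exact h
  have hρ2 : W.HasSurjectiveModNGaloisRep 2 := by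
    have h := hρ 1 one_pos
    rwa [pow_one] at h
  -- an odd-constant datum and a conductor-`1` Kolyvagin–Heegner datum over it
  obtain ⟨Dt₀, hc₀⟩ := hMan W (noRationalTwoTorsion_of_odd_torsionOrder W hT)
  obtain ⟨β, d₁, M₀, hy, hdiv, hndiv⟩ := exists_kolyvaginDatum_at_door hmod W hr K hK (hGZ _ W K) hH hLt Dt₀ ι
  -- the uncorrected bound there is the c-corrected one
  have hdvd := hX W hCM K hK hodd h3 hH hsq1 hsq2 hρ Dt₀ β ι d₁ hy M₀ hndiv
  have hle : padicValNat 2 (Nat.card (AddCommGroup.primaryComponent (W.baseChange K).sha 2)) ≤ 2 * M₀ :=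
    (Nat.pow_dvd_pow_iff_le_right one_lt_two).mp (dvd_trans pow_padicValNat_dvd hdvd)
  have hshaU : (padicValNat 2 (Nat.card (AddCommGroup.primaryComponent (W.baseChange K).sha 2)) : ℤ) +
      2 * padicValInt 2 Dt₀.c ≤ 2 * M₀ := by
    rw [padicValInt.eq_zero_of_not_dvd hc₀]
    push_cast
    exact_mod_cast hle
  obtain ⟨hrd, hrK⟩ := analyticRank_twin_and_baseChange_of_rankOne W K Dt₀ β ι d₁ Wd (hGZ _ W K) hmod hK hH hr hy ⟨Cd, hWd⟩
  have hKU : MissingUpperBoundOverCAt (W.baseChange K) 2 :=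
    (upperOverC_baseChange_two_iff_shaUpperC_at W K Dt₀ β ι d₁ (hGZ _ W K) hGZK hmod hρ2 hc hK hodd h3 hH hrK hdiv hndiv).mpr hshaU
  -- datum-free ⟹ joint upper half of the pair ⟹ U's inequality at the GIVEN datum `Dt`
  haveI hEK : (W.baseChange K).IsElliptic := isElliptic_baseChange' W K
  obtain ⟨-, hfinW⟩ := hGZK W hr.le
  obtain ⟨-, hfinD⟩ := hGZK Wd (by rw [hrd]; exact zero_le_one)
  have hV : ∃ C : VariableChange K, C • W.baseChange K = W.baseChange K := ⟨1, one_smul _ _⟩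
  obtain ⟨hshaK, hWR⟩ := hMilneC W K h2 Wd ⟨Cd, hWd⟩ (W.baseChange K) hV hfinW hfinD
  obtain ⟨-, -, -, -, q, q', hq, hq', -⟩ :=
    doorPairLedger_package_at W hT hc hr K hK (hGZ _ W K) (hKo _ W K) hadm hLt Dt H ι P hP Wd Cd hWd hnf hGZK
  have hJ : JointUpperBoundAt W Wd 2 :=
    jointUpperBoundAt_of_upperOverC W 2 K Wd (W.baseChange K) hmod h2 ⟨Cd, hWd⟩ hV hfinW hfinD hshaK hWR hKU ⟨q', hq'⟩
  exact (jointUpperBoundAt_two_iff_doorLawGeC_at W hT hc hr K hK (hGZ _ W K) (hKo _ W K) hadm hLt Dt H ι P hP Wd Cd hWd hnf hGZK).mp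
    hJ m hm

/-! ### §9 The twist-unit lever in DOOR CURRENCY (census-facing): `ord₂ (L(Wd,1)/Ω(Wd)) ≤ t + 2s` -/

/-- **The twin's analytic `Ш` in door currency, PRINT only**: at a door datum of a slice curve, for ANY rational values `q'` of `#Ш_an(Wd)`
and `q_d` of `L(Wd,1)/Ω(Wd)`: `ord₂ q' = ord₂ q_d − t − 2s` (odd `#Wd(ℚ)_tors`, `ord₂ ∏ c_ℓ(Wd) = t + 2s`; obtained by subtracting the two
PRINT-only ledgers `pairLedgerC_at` (p629541) and `pairShaAnLedger_at` (p630299)). [cite: Kramer1981, Prop. 3] [cite: Miller2011LMS, Def. 1.1] -/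
theorem padicValRat_shaAn_twin_eq_doorValue_at (hnf : exists_isNewformOf)
    (W : WeierstrassCurve ℚ) [W.IsElliptic] [W.IsGloballyMinimal] [NeZero (W.conductorNorm ℤ)]
    (hT : Odd W.torsionOrder) (hc : Odd W.tamagawaProduct) (hr : W.analyticRank = 1) (hrQ : W.mordellWeilRank = 1)
    (K : Type) [Field K] [NumberField K] (hK : IsImaginaryQuadratic K)
    (hGZ : gross_zagier (W.conductorNorm ℤ) W K) (hKo : kolyvagin (W.conductorNorm ℤ) W K)
    (hadm : DoorAdmissible W (NumberField.discr K))
    (hLt : (W.quadraticTwist (NumberField.discr K : ℚ)).entireLFunction 1 ≠ 0)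
    (Dt : ModularParametrizationData W (W.conductorNorm ℤ))
    (H : HeegnerDatum (W.conductorNorm ℤ) (NumberField.discr K)) (ι : K →+* ℂ)
    (P : (W.baseChange K).toAffine.Point)
    (hP : WeierstrassCurve.Affine.Point.map ι.toRatAlgHom P = heegnerPointComplex Dt H)
    (Wd : WeierstrassCurve ℚ) [Wd.IsElliptic] [Wd.IsGloballyMinimal] (Cd : VariableChange ℚ)
    (hWd : Cd • W.quadraticTwist (NumberField.discr K : ℚ) = Wd)
    {q' qd : ℚ} (hq' : shaAn Wd = (q' : ℂ)) (hqd : Wd.entireLFunction 1 / (Wd.realPeriodRat : ℂ) = (qd : ℂ)) :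
    padicValRat 2 q' = padicValRat 2 qd - transpCount W (NumberField.discr K) - 2 * identCount W (NumberField.discr K) := by
  have hmod : hasEntireLFunction_rat := hasEntireLFunction_rat_of_exists_isNewformOf hnf
  have hHN : SatisfiesHeegnerHypothesis (W.conductorNorm ℤ) K := satisfiesHeegnerHypothesis_of_doorAdmissible W K hK hadm
  obtain ⟨-, -, -, ⟨m, hm⟩, -, -, q₁, hq₁, -, hval₁⟩ :=
    pairLedgerC_at hmod W hT hc hr hrQ K hK hGZ hKo hadm hHN hLt Dt H ι P hP Wd Cd hWd qd hqd
  obtain ⟨-, -, q₂, q₂', hq₂, hq₂', -, -, hval₂⟩ :=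
    pairShaAnLedger_at hnf W hT hc hr hrQ K hK hGZ hKo hadm hHN hLt Dt H ι P hP Wd Cd hWd
  have h12 : q₂ = q₁ := by exact_mod_cast hq₂.symm.trans hq₁
  have h2' : q₂' = q' := by exact_mod_cast hq₂'.symm.trans hq'
  subst h12 h2'
  have hv₁ := hval₁ m hm
  have hv₂ := hval₂ m hm
  linarith

/-- **THE TWIST-UNIT LEVER IN DOOR CURRENCY (per datum): U and a door with `ord₂ (L(Wd,1)/Ω(Wd)) ≤ t + 2s` give the Euler-system half of
`BSD₂(W)` — NO rank-`0` `BSD₂` input.**  (`BSD₂(Wd)` predicts `ord₂ (L(Wd,1)/Ω(Wd)) = t + 2s + ord₂ #Ш(Wd)[2^∞] ≥ t + 2s` with equality iff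
`Ш(Wd)[2] = 0`; the hypothesis is a modular-symbol computation per door, an ANALYTIC statement class-wide.)  Conditional on U by design.
[cite: GrossLMS1991, Thm. 1.3] [cite: Kramer1981, Prop. 3] [cite: Miller2011LMS, Def. 1.1] -/
theorem missingUpperBoundAt_two_of_doorIndexLawUpperCAtTwo_of_doorValue_le_at
    (hGZK : rank_eq_analyticRank_of_analyticRank_le_one) (hnf : exists_isNewformOf) (hU : DoorIndexLawUpperCAtTwo)
    (W : WeierstrassCurve ℚ) [W.IsElliptic] [W.IsGloballyMinimal] [NeZero (W.conductorNorm ℤ)]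
    (hCM : ¬ W.HasCM) (hsurj : ∀ n : ℕ, W.HasSurjectiveModNGaloisRep ((2 ^ n : ℕ) : ℤ)) (hT : Odd W.torsionOrder)
    (hc : Odd W.tamagawaProduct) (hr : W.analyticRank = 1)
    (K : Type) [Field K] [NumberField K] (hK : IsImaginaryQuadratic K)
    (hGZ : gross_zagier (W.conductorNorm ℤ) W K) (hKo : kolyvagin (W.conductorNorm ℤ) W K)
    (hadm : DoorAdmissible W (NumberField.discr K))
    (hLt : (W.quadraticTwist (NumberField.discr K : ℚ)).entireLFunction 1 ≠ 0)
    (Dt : ModularParametrizationData W (W.conductorNorm ℤ))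
    (H : HeegnerDatum (W.conductorNorm ℤ) (NumberField.discr K)) (ι : K →+* ℂ)
    (P : (W.baseChange K).toAffine.Point)
    (hP : WeierstrassCurve.Affine.Point.map ι.toRatAlgHom P = heegnerPointComplex Dt H)
    (Wd : WeierstrassCurve ℚ) [Wd.IsElliptic] [Wd.IsGloballyMinimal] (Cd : VariableChange ℚ)
    (hWd : Cd • W.quadraticTwist (NumberField.discr K : ℚ) = Wd)
    {qd : ℚ} (hqd : Wd.entireLFunction 1 / (Wd.realPeriodRat : ℂ) = (qd : ℂ))
    (hval : padicValRat 2 qd ≤ transpCount W (NumberField.discr K) + 2 * identCount W (NumberField.discr K)) :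
    MissingUpperBoundAt W 2 := by
  obtain ⟨hrkW, -⟩ := hGZK W hr.le
  have hrQ : W.mordellWeilRank = 1 := by rw [hrkW, hr]
  obtain ⟨-, -, -, -, -, q', -, hq', -⟩ :=
    doorPairLedger_package_at W hT hc hr K hK hGZ hKo hadm hLt Dt H ι P hP Wd Cd hWd hnf hGZK
  have hv := padicValRat_shaAn_twin_eq_doorValue_at hnf W hT hc hr hrQ K hK hGZ hKo hadm hLt Dt H ι P hP Wd Cd hWd hq' hqd
  exact missingUpperBoundAt_two_of_doorIndexLawUpperCAtTwo_of_unitTwin_at hGZK hnf hU W hCM hsurj hT hc hr K hK hGZ hKo hadm hLt Dt H ι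
    P hP Wd Cd hWd ⟨q', hq', by rw [hv]; linarith⟩

/-- **The Euler-system half of `BSD₂` on the whole slice from U and a DOOR-VALUE SUPPLY** (`hSup`: every `W` on the slice has a
door-admissible `K` with `L(W^{(d_K)},1) ≠ 0` and a globally minimal twin `Wd` with `ord₂ (L(Wd,1)/Ω(Wd)) ≤ t + 2s` — a `2`-adic
non-vanishing statement for the quadratic twists of slice curves, nearest print Zhai 2016 / Cai–Li–Zhai 2020 / Kriz–Li 2019 at `p = 2`),
the four primary facts; NO rank-`0` `BSD₂` input.  Conditional by design; nothing is asserted about `hSup`. [cite: GrossLMS1991, Thm. 1.3]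
[cite: Miller2011LMS, Def. 1.1] -/
theorem missingUpperBoundAt_two_onSlice_of_doorIndexLawUpperCAtTwo_of_doorValueSupply
    (hGZ : ∀ (N : ℕ) [NeZero N] (W : WeierstrassCurve ℚ) (K : Type) [Field K] [NumberField K], gross_zagier N W K)
    (hKo : ∀ (N : ℕ) [NeZero N] (W : WeierstrassCurve ℚ) (K : Type) [Field K] [NumberField K], kolyvagin N W K)
    (hGZK : rank_eq_analyticRank_of_analyticRank_le_one) (hnf : exists_isNewformOf) (hU : DoorIndexLawUpperCAtTwo)
    (hSup : ∀ (W : WeierstrassCurve ℚ) [W.IsElliptic] [W.IsGloballyMinimal] [NeZero (W.conductorNorm ℤ)],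
      ¬ W.HasCM → (∀ n : ℕ, W.HasSurjectiveModNGaloisRep ((2 ^ n : ℕ) : ℤ)) → Odd W.torsionOrder → Odd W.tamagawaProduct →
      W.analyticRank = 1 →
      ∃ (K : Type) (_ : Field K) (_ : NumberField K), IsImaginaryQuadratic K ∧ DoorAdmissible W (NumberField.discr K) ∧
        (W.quadraticTwist (NumberField.discr K : ℚ)).entireLFunction 1 ≠ 0 ∧
        ∃ (Wd : WeierstrassCurve ℚ) (_ : Wd.IsElliptic) (_ : Wd.IsGloballyMinimal) (Cd : VariableChange ℚ) (qd : ℚ),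
          Cd • W.quadraticTwist (NumberField.discr K : ℚ) = Wd ∧ Wd.entireLFunction 1 / (Wd.realPeriodRat : ℂ) = (qd : ℂ) ∧
          padicValRat 2 qd ≤ transpCount W (NumberField.discr K) + 2 * identCount W (NumberField.discr K)) :
    ∀ (W : WeierstrassCurve ℚ) [W.IsElliptic] [W.IsGloballyMinimal], ¬ W.HasCM →
      (∀ n : ℕ, W.HasSurjectiveModNGaloisRep ((2 ^ n : ℕ) : ℤ)) → Odd W.torsionOrder → Odd W.tamagawaProduct →
      W.analyticRank = 1 → MissingUpperBoundAt W 2 := by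
  intro W _ _ hCM hsurj hT hc hr
  haveI hN : NeZero (W.conductorNorm ℤ) := ⟨(W.conductorNorm_pos_holds).ne'⟩
  obtain ⟨K, _iF, _iN, hK, hadm, hLt, Wd, _iE, _iM, Cd, qd, hWd, hqd, hval⟩ := hSup W hCM hsurj hT hc hr
  have hHN : SatisfiesHeegnerHypothesis (W.conductorNorm ℤ) K := satisfiesHeegnerHypothesis_of_doorAdmissible W K hK hadm
  obtain ⟨Dt⟩ := (nonempty_modularParametrizationData_iff_exists_isNewformOf_unconditional.mpr hnf) W
  obtain ⟨H, -⟩ :=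
    nonempty_heegnerDatum_holds (W.conductorNorm ℤ) K hK (exists_dvd_sq_sub_discr_holds (W.conductorNorm ℤ) K hK hHN).choose_spec
  obtain ⟨ι⟩ : Nonempty (K →+* ℂ) := inferInstance
  obtain ⟨P, hP⟩ := heegnerPointComplex_mem_range_map_holds (W.conductorNorm ℤ) W K hK hHN Dt H ι
  exact missingUpperBoundAt_two_of_doorIndexLawUpperCAtTwo_of_doorValue_le_at hGZK hnf hU W hCM hsurj hT hc hr K hK (hGZ _ W K)
    (hKo _ W K) hadm hLt Dt H ι P hP Wd Cd hWd hqd hval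

end Summit.BirchSwinnertonDyer.BirchSwinnertonDyer.Theorems.RankOneAtTwoOneDoor

end
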